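import Mathlib
import Summits.QuantumFields.YangMills.Theorems.TransportFieldPolyakovLineDerivative
import Literature.MathematicalPhysics.QuantumFieldTheory.ConstructiveQFTWave0WilsonLoopRPProofs
import HarnessLib

/-!
# Transport-field regularity kit, tranche 6: word surgery on direction-`0` Polyakov lines, the line count, and the Pauli trace identity

For `stub_transportDerivative` ⟨stmt-QuantumFields-23352⟩ (closed form of `XF`): when the link `(x,0)` is replaced by `U_{(x,0)}·g`,
* `trace_su2Rep_lineHolonomy_online` — for every base point `y = x+ê₀+kê₀` (`k < L`) on the `0`-line through `x`, the trace of the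
  length-`L` line from `y` becomes `tr(ρ(P₀(x+ê₀)) ρ(g))` (split the word at the shifted link with the tree's `lineHolonomy_add`, move the
  prefix behind the suffix by cyclicity of the trace, reassemble `P₀(x+ê₀)`);
* `lineHolonomy_update_offline'` — lines through base points off that `0`-line are unchanged;
* `exists_online_param`, `card_online` — the base points on the line are exactly `x+ê₀+kê₀`, `k < L`, and there are `L` of them;
* `re_trace_mul_su2Coord` — `Re tr(M·su2Coord v) = −2 Σ_a v_a Re(−i/2·tr(σ_a M))` (Print's coordinates against the colour vector).
HONEST FRAMING: lattice bookkeeping; no claim about the cruxes, K2a or the YM mass gap.  No `sorry`, no new axiom, no new definition.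
References: [cite: Balaban1985UV3, p. 260]; [cite: Luscher1983, §2].
-/

set_option autoImplicit false

noncomputable section

open scoped BigOperators
open Literature.MathematicalPhysics.QuantumFieldTheory (GaugeConfig Site Edge lineHolonomy)
open Literature.MathematicalPhysics.QuantumFieldTheory.WilsonLoopRP (lineHolonomy_add lineHolonomy_congr lineHolonomy_succ_right)
open Literature.MathematicalPhysics.QuantumFieldTheory.Balaban1983to89.B10Eq18SigmaSU2 (pauli su2Coord su2Coord_eq_sum)
open Complex

namespace Summit.QuantumFields.YangMills.Theorems.TransportField

open Summit.QuantumFields.YangMills.Theorems.FemtoTransferGap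

variable {L : ℕ} [NeZero L]

/-! ## §1 Sites on the `0`-line through `x` -/

omit [NeZero L] in
/-- `x + ê₀ + n ê₀ = x` exactly when `L ∣ n + 1`; in particular `≠ x` for `n + 1 < L`. [folklore] -/
theorem shift_add_single_ne (x : Site 3 L) {n : ℕ} (hn : n + 1 < L) :
    x.shift 0 + Pi.single (0 : Fin 3) ((n : ℕ) : ZMod L) ≠ x := by
  intro h
  have h0 := congrArg (fun z : Site 3 L => z 0 - x 0) h
  simp only [Site.shift, Pi.add_apply, Pi.single_eq_same, sub_self] at h0
  have h1 : ((n + 1 : ℕ) : ZMod L) = 0 := by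
    push_cast
    have : x 0 + 1 + (n : ZMod L) - x 0 = 1 + (n : ZMod L) := by ring
    rw [this] at h0
    rw [add_comm]; exact h0
  rw [ZMod.natCast_eq_zero_iff] at h1
  exact absurd (Nat.le_of_dvd (Nat.succ_pos n) h1) (by omega)

/-- `x + ê₀ + (L−1) ê₀ = x`. [folklore] -/
theorem shift_add_single_pred (x : Site 3 L) :
    x.shift 0 + Pi.single (0 : Fin 3) (((L - 1 : ℕ) : ℕ) : ZMod L) = x := by
  have hL : 1 ≤ L := Nat.one_le_iff_ne_zero.mpr (NeZero.ne L)
  funext i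
  simp only [Site.shift, Pi.add_apply]
  by_cases hi : i = 0
  · subst hi
    simp only [Pi.single_eq_same]
    have : (1 : ZMod L) + (((L - 1 : ℕ) : ℕ) : ZMod L) = 0 := by
      have h : (((1 + (L - 1) : ℕ) : ℕ) : ZMod L) = 0 := by
        rw [show 1 + (L - 1) = L by omega]; exact ZMod.natCast_self L
      push_cast at h
      exact h
    rw [add_assoc, this, add_zero]
  · simp only [Pi.single_apply, if_neg hi, add_zero]

/-- Base points with the same transverse coordinates as `x` are `x + ê₀ + kê₀`, `k < L`. [folklore] -/
theorem exists_online_param (x y : Site 3 L) (h1 : y 1 = x 1) (h2 : y 2 = x 2) :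
    ∃ k : ℕ, k < L ∧ y = x.shift 0 + Pi.single (0 : Fin 3) ((k : ℕ) : ZMod L) := by
  refine ⟨(y 0 - x 0 - 1).val, ZMod.val_lt _, ?_⟩
  funext i
  fin_cases i
  · show y 0 = ((x.shift 0 + Pi.single (0 : Fin 3) ((((y 0 - x 0 - 1).val : ℕ) : ℕ) : ZMod L) : Site 3 L)) 0
    simp only [Site.shift, Pi.add_apply, Pi.single_eq_same, ZMod.natCast_val, ZMod.cast_id', id_eq]
    ring
  · show y 1 = ((x.shift 0 + Pi.single (0 : Fin 3) ((((y 0 - x 0 - 1).val : ℕ) : ℕ) : ZMod L) : Site 3 L)) 1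
    simp [Site.shift, h1]
  · show y 2 = ((x.shift 0 + Pi.single (0 : Fin 3) ((((y 0 - x 0 - 1).val : ℕ) : ℕ) : ZMod L) : Site 3 L)) 2
    simp [Site.shift, h2]

/-- **There are exactly `L` base points on the `0`-line through `x`.** [folklore] -/
theorem card_online (x : Site 3 L) :
    (Finset.univ.filter fun y : Site 3 L => y 1 = x 1 ∧ y 2 = x 2).card = L := by
  classical
  have himg : (Finset.univ.filter fun y : Site 3 L => y 1 = x 1 ∧ y 2 = x 2) =
      Finset.univ.image (fun c : ZMod L => Function.update x 0 c) := by
    ext y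
    simp only [Finset.mem_filter, Finset.mem_univ, true_and, Finset.mem_image]
    constructor
    · rintro ⟨h1, h2⟩
      refine ⟨y 0, ?_⟩
      funext i
      fin_cases i
      · simp
      · simpa using h1.symm
      · simpa using h2.symm
    · rintro ⟨c, rfl⟩
      simp
  rw [himg, Finset.card_image_of_injective _ fun c c' h => by simpa using congrFun h 0]
  simp

/-! ## §2 Word surgery: the trace of an on-line Polyakov word after shifting the link `(x,0)` -/

omit [NeZero L] in
/-- Lines from base points off the `0`-line through `x` do not see the link `(x,0)`. [folklore] -/
theorem lineHolonomy_update_offline' (U : GaugeConfig 3 L SU2) (x y : Site 3 L) (v : SU2) (n : ℕ)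
    (h : y 1 ≠ x 1 ∨ y 2 ≠ x 2) : lineHolonomy (Function.update U (x, (0 : Fin 3)) v) 0 n y = lineHolonomy U 0 n y := by
  rcases h with h | h
  · exact lineHolonomy_update_offline U x v (by decide : (1 : Fin 3) ≠ 0) n y h
  · exact lineHolonomy_update_offline U x v (by decide : (2 : Fin 3) ≠ 0) n y h

omit [NeZero L] in
/-- A segment of the `0`-line starting at `x + ê₀ + kê₀` of length `n` with `k + n < L` does not see the link `(x,0)`. [folklore] -/
theorem lineHolonomy_segment_update (U : GaugeConfig 3 L SU2) (x : Site 3 L) (v : SU2) {k n : ℕ} (hkn : k + n < L) :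
    lineHolonomy (Function.update U (x, (0 : Fin 3)) v) 0 n (x.shift 0 + Pi.single (0 : Fin 3) ((k : ℕ) : ZMod L)) =
      lineHolonomy U 0 n (x.shift 0 + Pi.single (0 : Fin 3) ((k : ℕ) : ZMod L)) := by
  refine lineHolonomy_congr 0 n _ fun s hs => ?_
  have hne : x.shift 0 + Pi.single (0 : Fin 3) ((k : ℕ) : ZMod L) + Pi.single (0 : Fin 3) ((s : ℕ) : ZMod L) ≠ x := by
    rw [add_assoc, ← Pi.single_add, ← Nat.cast_add]
    exact shift_add_single_ne x (by omega)
  exact Function.update_of_ne (fun h => hne (congrArg Prod.fst h)) _ _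

/-- ★ **On-line word surgery.**  For `y = x + ê₀ + kê₀` (`k < L`), replacing the link `(x,0)` by `U_{(x,0)}·g` turns the trace of the
length-`L` Polyakov word from `y` into `tr(ρ(P₀(x+ê₀)) ρ(g))`. [cite: Luscher1983, §2] -/
theorem trace_su2Rep_lineHolonomy_online (U : GaugeConfig 3 L SU2) (x : Site 3 L) (g : SU2) {k : ℕ} (hk : k < L) :
    (su2Rep (lineHolonomy (Function.update U (x, (0 : Fin 3)) (U (x, (0 : Fin 3)) * g)) 0 L
        (x.shift 0 + Pi.single (0 : Fin 3) ((k : ℕ) : ZMod L)))).trace =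
      (su2Rep (lineHolonomy U 0 L (x.shift 0)) * su2Rep g).trace := by
  set W := Function.update U (x, (0 : Fin 3)) (U (x, (0 : Fin 3)) * g) with hW
  set y := x.shift 0 + Pi.single (0 : Fin 3) ((k : ℕ) : ZMod L) with hy
  -- `y + (L-1-k)ê₀ = x`
  have hyx : y + Pi.single (0 : Fin 3) (((L - 1 - k : ℕ) : ℕ) : ZMod L) = x := by
    rw [hy, add_assoc, ← Pi.single_add, ← Nat.cast_add, show k + (L - 1 - k) = L - 1 by omega]
    exact shift_add_single_pred x
  -- split the word from `y` at the shifted link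
  have hsplit := lineHolonomy_add W 0 (L - 1 - k) (k + 1) y
  rw [show L - 1 - k + (k + 1) = L by omega, hyx] at hsplit
  have hstep : lineHolonomy W 0 (k + 1) x = W (x, (0 : Fin 3)) * lineHolonomy W 0 k (x.shift 0) := rfl
  have hWx : W (x, (0 : Fin 3)) = U (x, (0 : Fin 3)) * g := by rw [hW, Function.update_self]
  have hA : lineHolonomy W 0 (L - 1 - k) y = lineHolonomy U 0 (L - 1 - k) y := by
    rw [hy, hW]; exact lineHolonomy_segment_update U x _ (by omega)
  have hC : lineHolonomy W 0 k (x.shift 0) = lineHolonomy U 0 k (x.shift 0) := by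
    have h := lineHolonomy_segment_update U x (U (x, (0 : Fin 3)) * g) (k := 0) (n := k) (by omega)
    simp only [Nat.cast_zero, Pi.single_zero, add_zero] at h
    rw [hW]; exact h
  -- reassemble `P₀(x+ê₀) = C · A · U_x`
  have hP : lineHolonomy U 0 k (x.shift 0) * lineHolonomy U 0 (L - 1 - k) y * U (x, (0 : Fin 3)) = lineHolonomy U 0 L (x.shift 0) := by
    have h1 := lineHolonomy_add U 0 k (L - 1 - k) (x.shift 0)
    rw [show k + (L - 1 - k) = L - 1 by omega, ← hy] at h1
    have h2 := lineHolonomy_succ_right U 0 (L - 1) (x.shift 0)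
    rw [show L - 1 + 1 = L from by have := Nat.one_le_iff_ne_zero.mpr (NeZero.ne L); omega, shift_add_single_pred] at h2
    rw [h2, h1]
  rw [hsplit, hstep, hWx, hA, hC]
  simp only [map_mul]
  rw [← hP]
  simp only [map_mul]
  -- cyclicity of the trace
  rw [show su2Rep (lineHolonomy U 0 (L - 1 - k) y) * (su2Rep (U (x, (0 : Fin 3))) * su2Rep g * su2Rep (lineHolonomy U 0 k (x.shift 0))) =
      (su2Rep (lineHolonomy U 0 (L - 1 - k) y) * su2Rep (U (x, (0 : Fin 3)))) * su2Rep g * su2Rep (lineHolonomy U 0 k (x.shift 0)) by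
    simp only [Matrix.mul_assoc], Matrix.trace_mul_cycle]
  simp only [Matrix.mul_assoc]

/-! ## §3 The Pauli trace identity -/

/-- **`Re tr(M · su2Coord v) = −2 Σ_a v_a · Re(−i/2 · tr(σ_a M))`.** [cite: Balaban1985UV3, p. 260] -/
theorem re_trace_mul_su2Coord (M : Matrix (Fin 2) (Fin 2) ℂ) (v : Fin 3 → ℝ) :
    (M * su2Coord v).trace.re = -2 * ∑ a : Fin 3, v a * (-(I / 2) * (pauli a * M).trace).re := by
  rw [su2Coord_eq_sum, Matrix.mul_sum, Matrix.trace_sum, Complex.re_sum, Finset.mul_sum]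
  refine Finset.sum_congr rfl fun a _ => ?_
  rw [Matrix.mul_smul, Matrix.trace_smul, Matrix.trace_mul_comm, smul_eq_mul]
  simp only [Complex.mul_re, Complex.mul_im, Complex.ofReal_re, Complex.ofReal_im, Complex.I_re, Complex.I_im, Complex.neg_re,
    Complex.neg_im, Complex.div_re, Complex.div_im]
  norm_num
  ring

end Summit.QuantumFields.YangMills.Theorems.TransportField

end
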